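import Summits.BirchSwinnertonDyer.BirchSwinnertonDyer.Theorems.GenusKolyvaginAtTwoOffCutResidualAtTwoRSocleSelectionRealVisibleCriterion
import Summits.BirchSwinnertonDyer.BirchSwinnertonDyer.Theorems.GenusKolyvaginAtTwoOffCutResidualAtTwoRSocleSelectionRealVisibleFrameData
import HarnessLib

/-!
# Route `GenusKolyvaginAtTwo`, residual `OffCutResidualAtTwoR` (stmt-BirchSwinnertonDyer-31767), LINE 27 «socle_selection» STUB S2, conjunct (HL) —
# THE VISIBILITY CRITERION DISCHARGED FOR AN ELLIPTIC CURVE: the non-zero Lawson–Wuthrich class of `H¹(Gal(L/K), E[2^k])` does NOT die on `⟨σ⟩`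
# for any `σ ∈ Γ_K` acting on `E[2^k]` as `diag(1, −1)` in some basis (`k ≥ 1`, `ρ̄_{E,2^k}` surjective, any field with `2 ≠ 0`)

Seat `bsd-line-gk2-p4` g30 (cell `bsd-f1-sign2`), WIDTH-5 attach on route `GenusKolyvaginAtTwo` rev 59; sequel of `…SocleSelectionRealVisibleCriterion`
(the abstract criterion).  `--supports stmt-BirchSwinnertonDyer-31767 --as helper`.  THEOREMS ONLY (no definition, no named fact, no `sorry`); standard
axioms.  **BSD is NOT proved by this file; `OffCutResidualAtTwoR` is NOT proved; LINE 27's stub S2 is NOT closed by this file alone.**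

WHAT.  In the frame `e : E[2^k] ≃ (ℤ/2^k)²`, `ρ : Γ_K → GL₂(ℤ/2^k)` of the tree's Lawson–Wuthrich discharge (`DivisionTowerH1OrderTwoFrames`,
`…SurjectiveElements`, `…Surjective`), for `E/K` elliptic over ANY field with `2 ≠ 0` and SURJECTIVE `ρ̄_{E,2^k}` (`k = j + 1 ≥ 1`):
* (part 1, `…SocleSelectionRealVisibleFrameData`: the frame data — diagonal family, `LDU`, special matrices — and the element `d` with
  `ρ(d) = diag(1, −1)`: ODD-exponent relations against `t, t'`, `E₁ + E₂ ∉ (d − 1)E[2^k]`);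
* §0 transport of principality along a conjugation `σ ↦ g⁻¹σg`;
* §3 ★ `not_mem_subgroupResKer_zpowers_of_split` — for ANY `σ ∈ Γ_K` with `E[2^k] = ⟨P⟩ + ⟨Q⟩`, `σP = P`, `σQ = −Q` (so `ρ(g⁻¹σg) = diag(1, −1)` for a
  `g` with `ρ(g) = (eP | eQ)`, by surjectivity) and ANY `N ⊇ Γ_{K(E[2^k])}`: **a non-zero `κ ∈ ker (H¹(Γ_K, E[2^k]) → H¹(N, E[2^k]))` is NOT in
  `ker (H¹(Γ_K, E[2^k]) → H¹(⟨σ⟩, E[2^k]))`** (criterion at `d = g⁻¹σg`, transported back along the conjugation); cocycle form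
  `apply_ne_smul_sub_of_split`.
READING for LINE 27 (Δ > 0 habitat cells over `ℚ` and over the Heegner field): complex conjugation `c` has `c² = 1` and fixes `E[2]`, whence
`E[2^k] = E[2^k]^{c = 1} + E[2^k]^{c = −1}` by halving in `E[2^(k+1)]` — the `(P, Q)` of §3 — so the LEVEL-`2^k` PHANTOM CLASS IS REAL-VISIBLE: a
class that is locally trivial at the real place and phantom is ZERO.  The passage from the real place of `ℚ` (resp. the places of `K` above it) to
an element `c ∈ Γ` and the `(P, Q)`-splitting is the next file.  BSD is NOT proved by any of this.

References: [LawsonWuthrich2016] Lemma 3, §2, §5, §7.1; [Sah1968] Prop. 2.7 (b); [SerreGaloisCohomology1997] I.§2.2, I.§5.8; [GrossLMS1991] §9.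
-/

set_option autoImplicit false
set_option linter.dupNamespace false -- `Summit.<P>.<Sub>` repeats `BirchSwinnertonDyer` (D-0017)

noncomputable section

open scoped Classical MatrixGroups

namespace Summit.BirchSwinnertonDyer.BirchSwinnertonDyer.Theorems.GenusExact.PlusDescent.SocleSelection.RealVisible

open WeierstrassCurve Field Matrix Literature.NumberTheory.EllipticCurves Literature.NumberTheory.GaloisRepresentations
open Literature.NumberTheory.EllipticCurves.LawsonWuthrich2016

universe u

/-! ## §0 One more cocycle identity: transport along a conjugation -/

section Algebra

variable {G : Type u} [Group G] {M : Type u} [AddCommGroup M] [DistribMulAction G M] {N : Subgroup G}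

/-- **Principal on `⟨σ⟩` ⟹ principal on `⟨g⁻¹σg⟩`**: if `f(σ) = σ • a − a` then `f(g⁻¹ σ g) = (g⁻¹ σ g) • b − b` with `b = g⁻¹ • (a + f(g))`.
[cite: SerreGaloisCohomology1997, I.§5.8] -/
theorem apply_conj_eq_smul_sub_of_apply_eq (f : cocyclesVanishingOn M N) {σ : G} (g : G) {a : M} (h : f.1 σ = σ • a - a) :
    f.1 (g⁻¹ * σ * g) = (g⁻¹ * σ * g) • (g⁻¹ • (a + f.1 g)) - g⁻¹ • (a + f.1 g) := by
  have hinv : f.1 g⁻¹ = -(g⁻¹ • f.1 g) := by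
    have h1 := cocyclesVanishingOn.cocycle f g⁻¹ g
    rw [inv_mul_cancel, apply_one] at h1
    exact eq_neg_of_add_eq_zero_left h1.symm
  rw [cocyclesVanishingOn.cocycle f, cocyclesVanishingOn.cocycle f, hinv, h, ← mul_smul (g⁻¹ * σ * g) g⁻¹, mul_assoc,
    mul_inv_cancel, mul_one, mul_smul, mul_smul, smul_add, smul_add, smul_sub, smul_add]
  abel

end Algebra

/-! ## §3 ★ The criterion discharged: a `σ` of `diag(1, −1)` type -/

section Main

variable {K : Type u} [Field K] (W : WeierstrassCurve K) [W.IsElliptic]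

/-- ★ **THE LAWSON–WUTHRICH CLASS IS VISIBLE ON `⟨σ⟩` FOR `σ` OF `diag(1, −1)` TYPE (cocycle form).**  `E/K` elliptic, `2 ≠ 0` in `K`, `ρ̄_{E,2^k}`
surjective (`k = j + 1`); `σ ∈ Γ_K` and `P, Q ∈ E[2^k]` with `σP = P`, `σQ = −Q` and `E[2^k] = ℤP + ℤQ`.  Then every crossed homomorphism
`f : Γ_K → E[2^k]` vanishing on `Γ_{K(E[2^k])}` with NON-ZERO class satisfies **`f(σ) ≠ σ • y − y` for all `y`** (its class does not die on `{1, σ}`).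
Proof: frame `e`, `ρ`; `B = (eP | eQ) ∈ GL₂` (columns span), `g` with `ρ(g) = B` (surjectivity), `d = g⁻¹σg` has `ρ(d) = diag(1, −1)`; the abstract
criterion (`…RealVisibleCriterion`) at `d` with the tree's frame data; transport back along `g` (§0).
[cite: LawsonWuthrich2016, Lemma 3, §7.1] [cite: Sah1968, Prop. 2.7 (b)] [cite: GrossLMS1991, §9] -/
theorem apply_ne_smul_sub_of_split (j : ℕ) (h2 : (2 : K) ≠ 0)
    (hsurj : W.HasSurjectiveModNGaloisRep ((2 ^ (j + 1) : ℕ) : ℤ))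
    {σ : absoluteGaloisGroup K} {P Q : geomTorsion W ((2 ^ (j + 1) : ℕ) : ℤ)}
    (hP : σ • P = P) (hQ : σ • Q = -Q) (hPQ : ∀ R : geomTorsion W ((2 ^ (j + 1) : ℕ) : ℤ), ∃ a b : ℤ, R = a • P + b • Q)
    (f : cocyclesVanishingOn (geomTorsion W ((2 ^ (j + 1) : ℕ) : ℤ)) (torsionFixing W ((2 ^ (j + 1) : ℕ) : ℤ)))
    (hf : inflClass (geomTorsion W ((2 ^ (j + 1) : ℕ) : ℤ)) (torsionFixing W ((2 ^ (j + 1) : ℕ) : ℤ))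
      (isOpen_torsionFixing W (by exact_mod_cast pow_ne_zero (j + 1) two_ne_zero)) f ≠ 0)
    (y : geomTorsion W ((2 ^ (j + 1) : ℕ) : ℤ)) : f.1 σ ≠ σ • y - y := by
  haveI : Fact (Nat.Prime 2) := ⟨Nat.prime_two⟩
  -- a frame and the framed representation
  obtain ⟨e⟩ := nonempty_addEquiv_geomTorsion W 2 (j + 1) (Nat.succ_pos j) h2
  obtain ⟨ρ, hρ⟩ := exists_rep_of_addEquiv W e
  have hn0 : (((2 ^ (j + 1) : ℕ) : ℤ)) ≠ 0 := by exact_mod_cast pow_ne_zero _ two_ne_zero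
  have hN₀ : IsOpen (torsionFixing W ((2 ^ (j + 1) : ℕ) : ℤ) : Set (absoluteGaloisGroup K)) := isOpen_torsionFixing W hn0
  have hNM : ∀ n ∈ torsionFixing W ((2 ^ (j + 1) : ℕ) : ℤ), ∀ x : geomTorsion W ((2 ^ (j + 1) : ℕ) : ℤ), n • x = x :=
    fun n hn x ↦ smul_eq_of_mem_torsionFixing W _ hn x
  -- the special elements
  obtain ⟨UT, hUT⟩ := exists_gl_T j
  obtain ⟨UT', hUT'⟩ := exists_gl_T' j
  obtain ⟨US, hUS⟩ := exists_gl_S j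
  obtain ⟨UZ, hUZ⟩ := exists_gl_Z j
  obtain ⟨t, ht⟩ := exists_rep_eq_of_hasSurjectiveModNGaloisRep W e ρ hρ hsurj UT
  obtain ⟨t', ht'⟩ := exists_rep_eq_of_hasSurjectiveModNGaloisRep W e ρ hρ hsurj UT'
  obtain ⟨s, hs⟩ := exists_rep_eq_of_hasSurjectiveModNGaloisRep W e ρ hρ hsurj US
  obtain ⟨z, hz⟩ := exists_rep_eq_of_hasSurjectiveModNGaloisRep W e ρ hρ hsurj UZ
  have hT : ((ρ t : GL (Fin 2) (ZMod (2 ^ (j + 1)))) : Matrix (Fin 2) (Fin 2) (ZMod (2 ^ (j + 1)))) = !![1, 1; 0, 1] := by rw [ht, hUT]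
  have hT' : ((ρ t' : GL (Fin 2) (ZMod (2 ^ (j + 1)))) : Matrix (Fin 2) (Fin 2) (ZMod (2 ^ (j + 1)))) = !![1, 0; 1, 1] := by rw [ht', hUT']
  have hS : ((ρ s : GL (Fin 2) (ZMod (2 ^ (j + 1)))) : Matrix (Fin 2) (Fin 2) (ZMod (2 ^ (j + 1)))) = !![0, 1; 1, 0] := by rw [hs, hUS]
  have hZ : ((ρ z : GL (Fin 2) (ZMod (2 ^ (j + 1)))) : Matrix (Fin 2) (Fin 2) (ZMod (2 ^ (j + 1)))) = !![3, 0; 0, 3] := by rw [hz, hUZ]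
  -- the change-of-basis matrix `B = (eP | eQ)` and `g` with `ρ(g) = B`
  set B : Matrix (Fin 2) (Fin 2) (ZMod (2 ^ (j + 1))) := !![e P 0, e Q 0; e P 1, e Q 1] with hB
  have hBmul : ∀ v : Fin 2 → ZMod (2 ^ (j + 1)), B *ᵥ v = v 0 • e P + v 1 • e Q := by
    intro v
    funext i; fin_cases i <;> simp [hB, Matrix.mulVec, dotProduct, Fin.sum_univ_two, mul_comm]
  have hBsurj : Function.Surjective B.mulVec := by
    intro w
    obtain ⟨a, b, hab⟩ := hPQ (e.symm w)
    refine ⟨![(a : ZMod (2 ^ (j + 1))), (b : ZMod (2 ^ (j + 1)))], ?_⟩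
    have hw : w = e (a • P + b • Q) := by rw [← hab, e.apply_symm_apply]
    rw [hBmul, hw, map_add, map_zsmul, map_zsmul]
    funext i
    simp [zsmul_eq_mul]
  obtain ⟨UB, hUB⟩ := (Matrix.mulVec_surjective_iff_isUnit).1 hBsurj
  obtain ⟨g, hg⟩ := exists_rep_eq_of_hasSurjectiveModNGaloisRep W e ρ hρ hsurj UB
  -- `ρ(σ) B = B D`
  have hσB : ((ρ σ : GL (Fin 2) (ZMod (2 ^ (j + 1)))) : Matrix (Fin 2) (Fin 2) (ZMod (2 ^ (j + 1)))) * B =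
      B * !![1, 0; 0, -1] := by
    refine eq_of_forall_mulVec_eq _ _ fun v ↦ ?_
    have hPv : ((ρ σ : GL (Fin 2) (ZMod (2 ^ (j + 1)))) : Matrix (Fin 2) (Fin 2) (ZMod (2 ^ (j + 1)))) *ᵥ e P = e P := by
      rw [← hρ, hP]
    have hQv : ((ρ σ : GL (Fin 2) (ZMod (2 ^ (j + 1)))) : Matrix (Fin 2) (Fin 2) (ZMod (2 ^ (j + 1)))) *ᵥ e Q = -e Q := by
      rw [← hρ, hQ, map_neg]
    rw [← Matrix.mulVec_mulVec, ← Matrix.mulVec_mulVec, hBmul, Matrix.mulVec_add, Matrix.mulVec_smul, Matrix.mulVec_smul, hPv, hQv,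
      hBmul]
    funext i; fin_cases i <;> simp [Matrix.mulVec, dotProduct, Fin.sum_univ_two]
  -- `d = g⁻¹ σ g` has `ρ(d) = diag(1, −1)`
  set d : absoluteGaloisGroup K := g⁻¹ * σ * g with hddef
  have hD : ((ρ d : GL (Fin 2) (ZMod (2 ^ (j + 1)))) : Matrix (Fin 2) (Fin 2) (ZMod (2 ^ (j + 1)))) = !![1, 0; 0, -1] := by
    rw [hddef, map_mul, map_mul, map_inv, Units.val_mul, Units.val_mul, hg, hUB, Matrix.mul_assoc, hσB, ← Matrix.mul_assoc,
      ← hUB, ← Units.val_mul, inv_mul_cancel, Units.val_one, Matrix.one_mul]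
  -- the abstract criterion at `d`
  have hdne : ∀ y' : geomTorsion W ((2 ^ (j + 1) : ℕ) : ℤ), f.1 d ≠ d • y' - y' := fun y' ↦
    apply_ne_smul_sub_of_inflClass_ne_zero hN₀ hNM
      (z_central W j e ρ hρ hZ) (z_smul W j e ρ hρ hZ)
      (two_zsmul_E₁ W j e) (two_zsmul_E₂ W j e) (E₁_ne_zero W j e) (E₂_ne_zero W j e) (E₁_ne_E₂ W j e)
      (mem_V_iff W j e) (halving W j e ρ hρ hT hT') (t_smul_E₁ W j e ρ hρ hT) (t_smul_E₂ W j e ρ hρ hT)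
      (t'_smul_E₁ W j e ρ hρ hT') (t'_smul_E₂ W j e ρ hρ hT') (swap_conj W j e ρ hρ hS hT hT')
      (fun δ : {δ : absoluteGaloisGroup K //
          ((ρ δ : GL (Fin 2) (ZMod (2 ^ (j + 1)))) : Matrix (Fin 2) (Fin 2) (ZMod (2 ^ (j + 1)))) 0 1 = 0 ∧
          ((ρ δ : GL (Fin 2) (ZMod (2 ^ (j + 1)))) : Matrix (Fin 2) (Fin 2) (ZMod (2 ^ (j + 1)))) 1 0 = 0} ↦
        (δ : absoluteGaloisGroup K))
      (fun δ ↦ mem_fixingSubgroup_of_diag W j e ρ hρ δ.2.1 δ.2.2)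
      (fun δ ↦ conj_diag_t W j e ρ hρ hT δ.2.1 δ.2.2) (fun δ ↦ conj_diag_t' W j e ρ hρ hT' δ.2.1 δ.2.2)
      (fun g' hg' ↦ ⟨g', mem_closure_of_mem_fixingSubgroup W j e ρ hρ hT hT' hg', 1, Subgroup.one_mem _, (mul_one g').symm⟩)
      (mem_fixingSubgroup_of_diag W j e ρ hρ (by rw [hD]; simp) (by rw [hD]; simp))
      (conj_diagNeg_t W j e ρ hρ hT hD) (conj_diagNeg_t' W j e ρ hρ hT' hD) (smul_sub_ne_E₁_add_E₂ W j e ρ hρ hD)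
      f hf y'
  -- transport back along `g`
  intro hy
  exact hdne (g⁻¹ • (y + f.1 g)) (apply_conj_eq_smul_sub_of_apply_eq f g hy)

/-- ★ **THE LAWSON–WUTHRICH CLASS IS VISIBLE ON `⟨σ⟩` (class form).**  `E/K` elliptic, `2 ≠ 0`, `ρ̄_{E,2^k}` surjective; `σ ∈ Γ_K`, `P, Q ∈ E[2^k]` with
`σP = P`, `σQ = −Q`, `E[2^k] = ℤP + ℤQ`; `N` ANY subgroup containing `Γ_{K(E[2^k])}` (e.g. `Gal(K̄/L)`, `L ⊆ K(E[2^k])`).  Then **a NON-ZERO class of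
`ker (H¹(Γ_K, E[2^k]) → H¹(N, E[2^k]))` is NOT in `ker (H¹(Γ_K, E[2^k]) → H¹(⟨σ⟩, E[2^k]))`**.  For `K = ℚ` (or the Heegner field), `Δ_E > 0` and `σ` a
complex conjugation this is the REAL VISIBILITY of the level-`2^k` phantom class used by LINE 27's (HL).  BSD is NOT proved by this.
[cite: LawsonWuthrich2016, Lemma 3, §7.1] [cite: SerreGaloisCohomology1997, I.§5.8] -/
theorem not_mem_subgroupResKer_zpowers_of_split (j : ℕ) (h2 : (2 : K) ≠ 0)
    (hsurj : W.HasSurjectiveModNGaloisRep ((2 ^ (j + 1) : ℕ) : ℤ))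
    (N : Subgroup (absoluteGaloisGroup K)) (hle : torsionFixing W ((2 ^ (j + 1) : ℕ) : ℤ) ≤ N)
    {σ : absoluteGaloisGroup K} {P Q : geomTorsion W ((2 ^ (j + 1) : ℕ) : ℤ)}
    (hP : σ • P = P) (hQ : σ • Q = -Q) (hPQ : ∀ R : geomTorsion W ((2 ^ (j + 1) : ℕ) : ℤ), ∃ a b : ℤ, R = a • P + b • Q)
    {κ : discreteH1 (absoluteGaloisGroup K) (geomTorsion W ((2 ^ (j + 1) : ℕ) : ℤ))}
    (hκ : κ ∈ subgroupResKer (geomTorsion W ((2 ^ (j + 1) : ℕ) : ℤ)) N) (hκ0 : κ ≠ 0) :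
    κ ∉ subgroupResKer (geomTorsion W ((2 ^ (j + 1) : ℕ) : ℤ)) (Subgroup.zpowers σ) := by
  have hn0 : (((2 ^ (j + 1) : ℕ) : ℤ)) ≠ 0 := by exact_mod_cast pow_ne_zero _ two_ne_zero
  have hN₀ : IsOpen (torsionFixing W ((2 ^ (j + 1) : ℕ) : ℤ) : Set (absoluteGaloisGroup K)) := isOpen_torsionFixing W hn0
  -- reduce to `N₀ = Γ_{K(E[2^k])}` and pick a representative vanishing on it
  have hκ' := Rubin1987.subgroupResKer_antitone (M := geomTorsion W ((2 ^ (j + 1) : ℕ) : ℤ)) hle hκ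
  have hrange := resKer_le_range_inflClass (subgroupIncl (torsionFixing W ((2 ^ (j + 1) : ℕ) : ℤ)))
    (AddMonoidHom.id (geomTorsion W ((2 ^ (j + 1) : ℕ) : ℤ))) (fun _ _ ↦ rfl) Function.bijective_id
    (torsionFixing W ((2 ^ (j + 1) : ℕ) : ℤ)) hN₀ (fun n hn ↦ ⟨⟨n, hn⟩, rfl⟩)
  obtain ⟨f, hfκ⟩ := hrange hκ'
  intro hmem
  rw [← hfκ, inflClass_apply] at hmem
  obtain ⟨a, ha⟩ := (oneCocycleClass_mem_subgroupResKer_iff (Subgroup.zpowers σ) _).1 hmem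
  have hσa := ha ⟨σ, Subgroup.mem_zpowers σ⟩
  rw [toContOneCocycle_apply] at hσa
  have hf0 : inflClass (geomTorsion W ((2 ^ (j + 1) : ℕ) : ℤ)) (torsionFixing W ((2 ^ (j + 1) : ℕ) : ℤ)) hN₀ f ≠ 0 := by
    rw [hfκ]; exact hκ0
  exact apply_ne_smul_sub_of_split W j h2 hsurj hP hQ hPQ f hf0 a hσa

end Main

end Summit.BirchSwinnertonDyer.BirchSwinnertonDyer.Theorems.GenusExact.PlusDescent.SocleSelection.RealVisible

end
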